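import Literature.Computability.QuantumComplexity.GraphStateCutRank
import Mathlib.LinearAlgebra.Matrix.Dual
import Mathlib.LinearAlgebra.Dual.Lemmas
import Mathlib.LinearAlgebra.FiniteDimensional.Lemmas
import HarnessLib

/-!
# Amplitudes of `-H-CZ-H-` Clifford circuits with a bipartite CZ pattern (Maslov et al. 2024)

Topic `Literature/Computability/QuantumComplexity` (pub-qadeq lane, CLAIMS §5 row E-16: Bluvstein et
al., Nature 626, 58 (2024), 48-logical-qubit IQP sampling — REFUTED in print by Maslov, Bravyi,
Tripier, Maksymov, Latone, *Fast classical simulation of Harvard/QuEra IQP circuits*,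
arXiv:2402.03211, whose per-slice workhorse is the closed formula below). Companion of
`GraphStateCutRank.lean` (same directory), whose sign character `chi` and character sum
`sum_chi_dotProduct` on `𝔽₂^B` it reuses.

HONEST FRAMING: instance-level adjudication of specific advantage claims; no claim about BQP vs BPP
or the summit. The file proves one printed identity of linear algebra over `𝔽₂`; it says nothing
about the `[[8,3,2]]` circuits, the covering-set reduction (Lemma 1), runtimes, or IQP hardness.

## Source statements formalised [cite: MaslovEtAl2024, §II eqs. (2)–(4)]

(We write `δ_G^y`, `δ_B^y` for the source's `δ` carrying superscript `G`/`B` and subscript `y`, and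
set the displays in plain text.) “Namely, fix a string x_R ∈ {0,1}^m. We can write f(x_R, x_G, x_B)
= x_G · Γx_B + δ_G · x_G + δ_B · x_B
(2) for some matrix Γ ∈ {0,1}^{m×m} and some vectors δ_G, δ_B ∈ {0,1}^m … Here the dots (·) denote
the inner product of binary vectors and Γx_B denotes matrix-vector multiplication. Then
⟨y_G y_B|H^{⊗2m}|GB(x_R)⟩ = (1/2^{2m}) Σ_{x_G, x_B ∈ {0,1}^m} (−1)^{x_G·Γx_B + δ_G^y·x_G +
δ_B^y·x_B},
where δ_G^y = δ_G + y_G and δ_B^y = δ_B + y_B. The above sum can be computed analytically resulting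
in ⟨y_G y_B|H^{⊗2m}|GB(x_R)⟩ = (−1)^{δ_B^y·Γ^{−1}δ_G^y}/2^{rank(Γ)} if δ_B^y ∈ Row(Γ) and
δ_G^y ∈ Col(Γ), 0 else. (3) Here we write Col(Γ) and Row(Γ) for the linear subspace of {0,1}^m
spanned by the columns and rows of Γ respectively. Finally, by a slight abuse of notations, we write
Γ^{−1}δ_G^y for any solution x_B ∈ {0,1}^m of the linear system Γx_B = δ_G^y (4) (we do not assume
that Γ is invertible). … The inner product δ_B^y · Γ^{−1}δ_G^y = δ_B^y · x_B in Eq. (3) is the same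
for all solutions x_B of the linear system Eq. (4) due to the condition δ_B^y ∈ Row(Γ). Indeed,
different solutions x_B of the linear system Eq. (4) differ by a vector from the nullspace of Γ.
Such vector is orthogonal to any row of Γ.” (p. 5); and (p. 6) “the matrix Γ is symmetric and the
vector x_R always belongs to the nullspace of Γ. Accordingly, the row space and the column space of
Γ are the same. The Clifford amplitude computed in Eq.(3) is zero whenever δ_G^y · x_R = 1 or
δ_B^y · x_R = 1. Indeed, since x_R belongs to the nullspace of Γ, it is orthogonal to any vector in
the row space or the column space of Γ.”

## Contents (all proved; 0 named facts) — rectangular `Γ : Matrix G B 𝔽₂`, values in any field `K`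
with `2 ≠ 0`; the source's square case is `G = B = Fin m`

* `phasePoly Γ δG δB xG xB = x_G·Γx_B + δ_G·x_G + δ_B·x_B` (eq. (2)); `phaseSum` = the double sign
  sum; `amplitude = phaseSum / 2^{|G|+|B|}` (the left side of eq. (3), with `δ^y` renamed `δ`).
* `InCol Γ δG` (`∃ x, Γx = δ_G`), `InRow Γ δB` (`∃ w, wΓ = δ_B`) and **`inRow_iff_forall_ker`**
  (`δ_B ∈ Row(Γ)` iff `δ_B` is orthogonal to the nullspace of `Γ` — the fact the well-definedness
  remark uses, here in both directions via Mathlib's `range_dualMap_eq_dualAnnihilator_ker`).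
* `sol Γ δG` — a chosen solution of `Γx = δ_G` (“Γ^{−1}δ_G … any solution”), and
  `dotProduct_eq_of_mulVec_eq` (the printed well-definedness: all solutions give the same
  `δ_B·x_B`).
* `sum_chi_ker` (the character sum over the nullspace: `#ker` or `0`), `card_ker` (`#ker Γ =
  2^{|B| − rank Γ}`, rank–nullity), `sum_chi_solutions` (affine shift).
* **`phaseSum_eq`** and **`amplitude_eq`** — eq. (3):
  `amplitude = (−1)^{δ_B·sol}/2^{rank Γ}` if `δ_B ∈ Row(Γ)` and `δ_G ∈ Col(Γ)`, else `0`.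
* `inRow_iff_inCol_of_isSymm` (symmetric `Γ`: Row = Col) and `amplitude_eq_zero_of_ker_witness_B/G`
  (the p. 6 “3/4 discard” test: a nullspace vector `x_R` with `δ_B·x_R = 1`, or — for symmetric `Γ`
  —
  with `δ_G·x_R = 1`, forces amplitude `0`).

## References

* [MaslovEtAl2024] D. Maslov, S. Bravyi, F. Tripier, A. Maksymov, J. Latone, *Fast classical
  simulation of Harvard/QuEra IQP circuits*, arXiv:2402.03211 (2024): §II eqs. (1)–(4), Lemma 2;
  p. 6 first paragraph. Read via `lit read arxiv:2402.03211` (fetched PDF text p0004 L31–L60, p0005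
  L1–L56, p0006 L12–L19).
* [HeinEisertBriegel2004] for the character machinery reused from `GraphStateCutRank.lean`.
-/

noncomputable section

open Matrix Finset

namespace Literature.Computability.QuantumComplexity

namespace BipartiteCZAmplitude

open GraphStateCutRank

variable {K : Type*} [Field K]
variable {G B : Type*} [Fintype G] [DecidableEq G] [Fintype B] [DecidableEq B]

/-! ### The phase polynomial and the sums -/

omit [DecidableEq G] [DecidableEq B] in
/-- The degree-2 phase polynomial of a fixed slice, `f(x_G, x_B) = x_G·Γx_B + δ_G·x_G + δ_B·x_B`.
[cite: MaslovEtAl2024, §II eq. (2)] -/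
def phasePoly (Γ : Matrix G B (ZMod 2)) (δG : G → ZMod 2) (δB : B → ZMod 2) (xG : G → ZMod 2)
    (xB : B → ZMod 2) : ZMod 2 :=
  xG ⬝ᵥ (Γ *ᵥ xB) + δG ⬝ᵥ xG + δB ⬝ᵥ xB

/-- The double sign sum `Σ_{x_G, x_B} (−1)^{x_G·Γx_B + δ_G·x_G + δ_B·x_B}`.
[cite: MaslovEtAl2024, §II (display before eq. (3))] -/
def phaseSum (Γ : Matrix G B (ZMod 2)) (δG : G → ZMod 2) (δB : B → ZMod 2) : K :=
  ∑ xG : G → ZMod 2, ∑ xB : B → ZMod 2, chi (phasePoly Γ δG δB xG xB)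

/-- The amplitude `⟨y_G y_B|H^{⊗(|G|+|B|)}|GB⟩ = 2^{−(|G|+|B|)} Σ_{x_G,x_B} (−1)^{f(x_G,x_B)}`
(with the
source's `δ^y = δ + y` already absorbed into `δ`). [cite: MaslovEtAl2024, §II (display before
eq. (3))] -/
def amplitude (Γ : Matrix G B (ZMod 2)) (δG : G → ZMod 2) (δB : B → ZMod 2) : K :=
  phaseSum Γ δG δB / 2 ^ (Fintype.card G + Fintype.card B)

omit [Fintype G] [DecidableEq G] [DecidableEq B] in
/-- `δ_G ∈ Col(Γ)`: the linear system `Γ x_B = δ_G` is feasible. [cite: MaslovEtAl2024, §II eqs.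
(3)–(4) (“This system is feasible whenever δ_G^y ∈ Col(Γ)”)] -/
def InCol (Γ : Matrix G B (ZMod 2)) (δG : G → ZMod 2) : Prop := ∃ x : B → ZMod 2, Γ *ᵥ x = δG

omit [DecidableEq G] [Fintype B] [DecidableEq B] in
/-- `δ_B ∈ Row(Γ)`: `δ_B` is a combination `wΓ` of the rows. [cite: MaslovEtAl2024, §II eq. (3)
(“Row(Γ) for the linear subspace … spanned by the … rows of Γ”)] -/
def InRow (Γ : Matrix G B (ZMod 2)) (δB : B → ZMod 2) : Prop := ∃ w : G → ZMod 2, w ᵥ* Γ = δB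

omit [Fintype G] [DecidableEq G] [DecidableEq B] in
open Classical in
/-- A chosen solution `x_B` of `Γ x_B = δ_G` (“by a slight abuse of notations, we write Γ^{−1}δ_G
for any solution”), and `0` if there is none. [cite: MaslovEtAl2024, §II eq. (4)] -/
def sol (Γ : Matrix G B (ZMod 2)) (δG : G → ZMod 2) : B → ZMod 2 :=
  if h : InCol Γ δG then Classical.choose h else 0

omit [Fintype G] [DecidableEq G] [DecidableEq B] in
/-- The chosen solution solves the system when it is feasible. [cite: MaslovEtAl2024, §II eq. (4)]
-/
theorem mulVec_sol {Γ : Matrix G B (ZMod 2)} {δG : G → ZMod 2} (h : InCol Γ δG) :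
    Γ *ᵥ sol Γ δG = δG := by
  rw [sol, dif_pos h]
  exact Classical.choose_spec h

/-! ### Row space = orthogonal complement of the nullspace -/

omit [DecidableEq G] [DecidableEq B] in
/-- Rows are orthogonal to the nullspace: `δ_B = wΓ` and `Γz = 0` give `δ_B·z = w·Γz = 0`.
[cite: MaslovEtAl2024, §II (“Such vector is orthogonal to any row of Γ”)] -/
theorem InRow.dotProduct_eq_zero {Γ : Matrix G B (ZMod 2)} {δB : B → ZMod 2} (h : InRow Γ δB)
    {z : B → ZMod 2} (hz : Γ *ᵥ z = 0) : δB ⬝ᵥ z = 0 := by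
  obtain ⟨w, rfl⟩ := h
  rw [← dotProduct_mulVec, hz, dotProduct_zero]

/-- **`δ_B ∈ Row(Γ)` iff `δ_B` is orthogonal to the nullspace of `Γ`** (over the field `𝔽₂`; the
converse direction is `range(Γᵀ) = (ker Γ)^⊥`, via Mathlib's `range_dualMap_eq_dualAnnihilator_ker`
and the dot-product identification of `𝔽₂^B` with its dual). [cite: MaslovEtAl2024, §II eq. (3) and
the well-definedness remark] -/
theorem inRow_iff_forall_ker (Γ : Matrix G B (ZMod 2)) (δB : B → ZMod 2) :
    InRow Γ δB ↔ ∀ z : B → ZMod 2, Γ *ᵥ z = 0 → δB ⬝ᵥ z = 0 := by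
  constructor
  · exact fun h z hz => h.dotProduct_eq_zero hz
  · intro h
    -- the functional `δ_B · (−)` kills `ker Γ`, hence factors through `Γ`
    have hmem : dotProductEquiv (ZMod 2) B δB ∈ (LinearMap.ker Γ.mulVecLin).dualAnnihilator := by
      rw [Submodule.mem_dualAnnihilator]
      intro z hz
      rw [LinearMap.mem_ker, mulVecLin_apply] at hz
      simpa using h z hz
    rw [← LinearMap.range_dualMap_eq_dualAnnihilator_ker, LinearMap.mem_range] at hmem
    obtain ⟨φ, hφ⟩ := hmem
    refine ⟨(dotProductEquiv (ZMod 2) G).symm φ, ?_⟩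
    have key : ∀ z : B → ZMod 2, ((dotProductEquiv (ZMod 2) G).symm φ ᵥ* Γ) ⬝ᵥ z = δB ⬝ᵥ z := by
      intro z
      have h1 := congrArg (fun ψ : Module.Dual (ZMod 2) (B → ZMod 2) => ψ z) hφ
      simp only [LinearMap.dualMap_apply, mulVecLin_apply, dotProductEquiv_apply_apply] at h1
      rw [← dotProduct_mulVec, ← h1]
      have h2 := (dotProductEquiv (ZMod 2) G).apply_symm_apply φ
      exact (congrArg (fun ψ : Module.Dual (ZMod 2) (G → ZMod 2) => ψ (Γ *ᵥ z)) h2 :)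
    -- two vectors with the same dot products against everything coincide
    have := (dotProductEquiv (ZMod 2) B).injective
      (LinearMap.ext fun z => by simpa using key z :
        dotProductEquiv (ZMod 2) B ((dotProductEquiv (ZMod 2) G).symm φ ᵥ* Γ) =
          dotProductEquiv (ZMod 2) B δB)
    exact this

omit [Fintype G] [DecidableEq G] [DecidableEq B] in
/-- **Well-definedness of `δ_B · Γ^{−1}δ_G`**: if `δ_B` is orthogonal to the nullspace, all
solutions
of `Γx = δ_G` have the same `δ_B · x`. [cite: MaslovEtAl2024, §II (“The inner product … is the same
for all solutions x_B of the linear system Eq. (4)”)] -/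
theorem dotProduct_eq_of_mulVec_eq {Γ : Matrix G B (ZMod 2)} {δG : G → ZMod 2} {δB : B → ZMod 2}
    (h : ∀ z : B → ZMod 2, Γ *ᵥ z = 0 → δB ⬝ᵥ z = 0) {x x' : B → ZMod 2} (hx : Γ *ᵥ x = δG)
    (hx' : Γ *ᵥ x' = δG) : δB ⬝ᵥ x = δB ⬝ᵥ x' := by
  have hz : Γ *ᵥ (x - x') = 0 := by rw [mulVec_sub, hx, hx', sub_self]
  have := h _ hz
  rwa [dotProduct_sub, sub_eq_zero] at this

/-! ### The three summations -/

omit [Fintype B] [DecidableEq B] in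
/-- In `𝔽₂^B`, `y + y' = 0 ↔ y = y'`. [folklore] -/
private theorem add_eq_zero_iff_eq₂ (y y' : B → ZMod 2) : y + y' = 0 ↔ y = y' := by
  simp only [funext_iff, Pi.add_apply, Pi.zero_apply]
  refine forall_congr' fun b => ?_
  generalize y b = u
  generalize y' b = v
  revert u v
  decide

omit [DecidableEq B] in
/-- Summing out `x_G`: `Σ_{x_G} (−1)^{f(x_G,x_B)} = 2^{|G|} (−1)^{δ_B·x_B} [Γx_B = δ_G]`.
[cite: MaslovEtAl2024, §II eq. (3) (derivation)] -/
theorem sum_xG [NeZero (2 : K)] (Γ : Matrix G B (ZMod 2)) (δG : G → ZMod 2) (δB : B → ZMod 2)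
    (xB : B → ZMod 2) :
    ∑ xG : G → ZMod 2, (chi (phasePoly Γ δG δB xG xB) : K) =
      if Γ *ᵥ xB = δG then (2 : K) ^ Fintype.card G * chi (δB ⬝ᵥ xB) else 0 := by
  have hrw : ∀ xG : G → ZMod 2,
      phasePoly Γ δG δB xG xB = xG ⬝ᵥ (Γ *ᵥ xB + δG) + δB ⬝ᵥ xB := by
    intro xG
    rw [phasePoly, dotProduct_add, dotProduct_comm δG xG]
  simp_rw [hrw, chi_add, ← sum_mul, sum_chi_dotProduct, add_eq_zero_iff_eq₂]
  split_ifs <;> simp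

omit [DecidableEq G] in
/-- **The character sum over the nullspace**: `Σ_{z ∈ ker Γ} (−1)^{δ_B·z}` is `#ker Γ` if `δ_B` is
orthogonal to the nullspace and `0` otherwise. [cite: MaslovEtAl2024, §II eq. (3) (derivation)] -/
theorem sum_chi_ker [NeZero (2 : K)] (Γ : Matrix G B (ZMod 2)) (δB : B → ZMod 2) :
    ∑ z : B → ZMod 2, (if Γ *ᵥ z = 0 then (chi (δB ⬝ᵥ z) : K) else 0) =
      if ∀ z : B → ZMod 2, Γ *ᵥ z = 0 → δB ⬝ᵥ z = 0
      then ((univ.filter fun z : B → ZMod 2 => Γ *ᵥ z = 0).card : K) else 0 := by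
  split_ifs with h
  · rw [← sum_filter]
    calc ∑ z ∈ univ.filter (fun z : B → ZMod 2 => Γ *ᵥ z = 0), (chi (δB ⬝ᵥ z) : K)
        = ∑ _z ∈ univ.filter (fun z : B → ZMod 2 => Γ *ᵥ z = 0), (1 : K) :=
          sum_congr rfl fun z hz => by rw [h z (mem_filter.1 hz).2, chi_zero]
      _ = _ := by rw [sum_const, nsmul_eq_mul, mul_one]
  · push Not at h
    obtain ⟨z₀, hz₀, hne⟩ := h
    set S := ∑ z : B → ZMod 2, (if Γ *ᵥ z = 0 then (chi (δB ⬝ᵥ z) : K) else 0) with hS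
    have hflip : S = -S := by
      calc S = ∑ z : B → ZMod 2, (if Γ *ᵥ (z + z₀) = 0 then (chi (δB ⬝ᵥ (z + z₀)) : K) else 0) :=
            (Fintype.sum_equiv (Equiv.addRight z₀) _ _ fun _ => rfl).symm
        _ = ∑ z : B → ZMod 2, -(if Γ *ᵥ z = 0 then (chi (δB ⬝ᵥ z) : K) else 0) := by
            refine sum_congr rfl fun z _ => ?_
            rw [mulVec_add, hz₀, add_zero, dotProduct_add, chi_add, chi_of_ne_zero hne]
            split_ifs <;> simp
        _ = -S := sum_neg_distrib ..
    have h2 : (2 : K) * S = 0 := by rw [two_mul]; nth_rewrite 2 [hflip]; exact add_neg_cancel S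
    exact (mul_eq_zero.mp h2).resolve_left two_ne_zero

omit [DecidableEq G] in
/-- **The nullspace has `2^{|B| − rank Γ}` elements** (rank–nullity over `𝔽₂`).
[cite: MaslovEtAl2024, §II eq. (3) (the factor `2^{rank(Γ)}`)] -/
theorem card_ker (Γ : Matrix G B (ZMod 2)) :
    (univ.filter fun z : B → ZMod 2 => Γ *ᵥ z = 0).card = 2 ^ (Fintype.card B - Γ.rank) := by
  classical
  haveI : Fintype ↥(LinearMap.ker Γ.mulVecLin) := Fintype.ofFinite _
  have h1 : Fintype.card ↥(LinearMap.ker Γ.mulVecLin) =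
      2 ^ Module.finrank (ZMod 2) ↥(LinearMap.ker Γ.mulVecLin) := by
    rw [Module.card_eq_pow_finrank (K := ZMod 2) (V := ↥(LinearMap.ker Γ.mulVecLin)), ZMod.card]
  have h2 : Module.finrank (ZMod 2) ↥(LinearMap.ker Γ.mulVecLin) = Fintype.card B - Γ.rank := by
    have := LinearMap.finrank_range_add_finrank_ker Γ.mulVecLin
    rw [Module.finrank_fintype_fun_eq_card] at this
    rw [Matrix.rank]
    omega
  have h3 : Fintype.card ↥(LinearMap.ker Γ.mulVecLin) =
      (univ.filter fun z : B → ZMod 2 => Γ *ᵥ z = 0).card := by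
    rw [← Fintype.card_subtype]
    exact Fintype.card_congr (Equiv.subtypeEquivRight fun z => by simp [LinearMap.mem_ker])
  rw [← h3, h1, h2]

omit [DecidableEq G] in
/-- Summing over the affine solution set: with one solution `x₀` of `Γx = δ_G`,
`Σ_{x : Γx = δ_G} (−1)^{δ_B·x} = (−1)^{δ_B·x₀} Σ_{z ∈ ker Γ} (−1)^{δ_B·z}`.
[cite: MaslovEtAl2024, §II (“different solutions … differ by a vector from the nullspace of Γ”)] -/
theorem sum_chi_solutions {Γ : Matrix G B (ZMod 2)} {δG : G → ZMod 2} (δB : B → ZMod 2)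
    {x₀ : B → ZMod 2} (hx₀ : Γ *ᵥ x₀ = δG) :
    ∑ x : B → ZMod 2, (if Γ *ᵥ x = δG then (chi (δB ⬝ᵥ x) : K) else 0) =
      chi (δB ⬝ᵥ x₀) * ∑ z : B → ZMod 2, (if Γ *ᵥ z = 0 then (chi (δB ⬝ᵥ z) : K) else 0) := by
  rw [mul_sum]
  calc ∑ x : B → ZMod 2, (if Γ *ᵥ x = δG then (chi (δB ⬝ᵥ x) : K) else 0)
      = ∑ z : B → ZMod 2, (if Γ *ᵥ (z + x₀) = δG then (chi (δB ⬝ᵥ (z + x₀)) : K) else 0) :=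
        (Fintype.sum_equiv (Equiv.addRight x₀) _ _ fun _ => rfl).symm
    _ = ∑ z : B → ZMod 2, chi (δB ⬝ᵥ x₀) * (if Γ *ᵥ z = 0 then (chi (δB ⬝ᵥ z) : K) else 0) := by
        refine sum_congr rfl fun z _ => ?_
        by_cases hz : Γ *ᵥ z = 0
        · rw [if_pos hz, if_pos (by rw [mulVec_add, hx₀, hz, zero_add]), dotProduct_add, chi_add,
            mul_comm]
        · rw [if_neg hz, mul_zero, if_neg]
          intro h
          apply hz
          rwa [mulVec_add, hx₀, add_eq_right] at h

/-! ### Eq. (3) -/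

open Classical in
/-- **Maslov et al. eq. (3), un-normalised**: `Σ_{x_G,x_B} (−1)^{f} = (−1)^{δ_B·Γ^{−1}δ_G} ·
2^{|G|} · 2^{|B| − rank Γ}` if `δ_G ∈ Col(Γ)` and `δ_B ∈ Row(Γ)`, and `0` otherwise.
[cite: MaslovEtAl2024, §II eq. (3)] -/
theorem phaseSum_eq [NeZero (2 : K)] (Γ : Matrix G B (ZMod 2)) (δG : G → ZMod 2)
    (δB : B → ZMod 2) :
    (phaseSum Γ δG δB : K) =
      if InCol Γ δG ∧ InRow Γ δB then
        chi (δB ⬝ᵥ sol Γ δG) * (2 : K) ^ Fintype.card G * (2 : K) ^ (Fintype.card B - Γ.rank)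
      else 0 := by
  unfold phaseSum
  rw [sum_comm]
  simp_rw [sum_xG]
  -- pull the constant out and rewrite the `x_B`-sum as a sum over solutions
  have hre : ∑ xB : B → ZMod 2,
      (if Γ *ᵥ xB = δG then (2 : K) ^ Fintype.card G * chi (δB ⬝ᵥ xB) else 0) =
      (2 : K) ^ Fintype.card G *
        ∑ xB : B → ZMod 2, (if Γ *ᵥ xB = δG then (chi (δB ⬝ᵥ xB) : K) else 0) := by
    rw [mul_sum]
    exact sum_congr rfl fun xB _ => by split_ifs <;> simp
  rw [hre]
  by_cases hcol : InCol Γ δG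
  · rw [sum_chi_solutions δB (mulVec_sol hcol), sum_chi_ker, inRow_iff_forall_ker]
    by_cases hrow : ∀ z : B → ZMod 2, Γ *ᵥ z = 0 → δB ⬝ᵥ z = 0
    · rw [if_pos hrow, if_pos ⟨hcol, hrow⟩, card_ker]
      push_cast
      ring
    · rw [if_neg hrow, if_neg (fun h => hrow h.2)]
      simp
  · have h0 : ∀ xB : B → ZMod 2, ¬ Γ *ᵥ xB = δG := fun xB h => hcol ⟨xB, h⟩
    simp_rw [if_neg (h0 _), sum_const_zero, mul_zero]
    rw [if_neg (fun h => hcol h.1)]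

omit [Fintype G] [DecidableEq G] [DecidableEq B] in
/-- `rank Γ ≤ |B|`. [folklore] -/
private theorem rank_le_card (Γ : Matrix G B (ZMod 2)) : Γ.rank ≤ Fintype.card B :=
  Γ.rank_le_card_width

open Classical in
/-- **Maslov et al. eq. (3)**: the amplitude of the `-H-CZ-H-` slice is
`(−1)^{δ_B·Γ^{−1}δ_G}/2^{rank(Γ)}` if `δ_B ∈ Row(Γ)` and `δ_G ∈ Col(Γ)`, and `0` else — “computing
amplitudes Eq. (3) requires only the standard linear algebra over the binary field: computing the
rank of a matrix and solving linear systems”. [cite: MaslovEtAl2024, §II eq. (3)] -/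
theorem amplitude_eq [NeZero (2 : K)] (Γ : Matrix G B (ZMod 2)) (δG : G → ZMod 2)
    (δB : B → ZMod 2) :
    (amplitude Γ δG δB : K) =
      if InCol Γ δG ∧ InRow Γ δB then chi (δB ⬝ᵥ sol Γ δG) / (2 : K) ^ Γ.rank else 0 := by
  rw [amplitude, phaseSum_eq]
  have h2 : (2 : K) ≠ 0 := two_ne_zero
  split_ifs with h
  · have hr := rank_le_card Γ
    rw [div_eq_div_iff (pow_ne_zero _ h2) (pow_ne_zero _ h2)]
    rw [show Fintype.card G + Fintype.card B =
        Fintype.card G + (Fintype.card B - Γ.rank) + Γ.rank by omega, pow_add, pow_add]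
    ring
  · rw [zero_div]

open Classical in
/-- The value does not depend on the chosen solution: for ANY solution `x` of `Γx = δ_G` (and
`δ_B ∈ Row(Γ)`), `amplitude = (−1)^{δ_B·x}/2^{rank Γ}`. [cite: MaslovEtAl2024, §II eqs. (3)–(4)
(“Thus Eq. (3) is well defined, even if Γ is not an invertible matrix”)] -/
theorem amplitude_eq_of_solution [NeZero (2 : K)] {Γ : Matrix G B (ZMod 2)} {δG : G → ZMod 2}
    {δB : B → ZMod 2} (hrow : InRow Γ δB) {x : B → ZMod 2} (hx : Γ *ᵥ x = δG) :
    (amplitude Γ δG δB : K) = chi (δB ⬝ᵥ x) / (2 : K) ^ Γ.rank := by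
  have hcol : InCol Γ δG := ⟨x, hx⟩
  rw [amplitude_eq, if_pos ⟨hcol, hrow⟩,
    dotProduct_eq_of_mulVec_eq ((inRow_iff_forall_ker Γ δB).1 hrow) (mulVec_sol hcol) hx]

/-! ### The symmetric case and the nullspace test (p. 6) -/

omit [DecidableEq B] in
/-- For symmetric `Γ` the row space and the column space coincide.
[cite: MaslovEtAl2024, p. 6 (“the matrix Γ is symmetric … Accordingly, the row space and the column
space of Γ are the same”)] -/
theorem inRow_iff_inCol_of_isSymm {Γ : Matrix B B (ZMod 2)} (hΓ : Γ.IsSymm) (δ : B → ZMod 2) :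
    InRow Γ δ ↔ InCol Γ δ := by
  unfold InRow InCol
  refine exists_congr fun w => ?_
  rw [← mulVec_transpose, hΓ.eq]

open Classical in
/-- **The nullspace test, `δ_B` half**: a nullspace vector `x_R` with `δ_B · x_R = 1` forces the
amplitude to vanish (`δ_B ∉ Row(Γ)`). [cite: MaslovEtAl2024, p. 6 (“The Clifford amplitude computed
in Eq.(3) is zero whenever … δ_B^y · x_R = 1”)] -/
theorem amplitude_eq_zero_of_ker_witness_B [NeZero (2 : K)] {Γ : Matrix G B (ZMod 2)}
    (δG : G → ZMod 2) {δB : B → ZMod 2} {xR : B → ZMod 2} (hker : Γ *ᵥ xR = 0)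
    (hne : δB ⬝ᵥ xR ≠ 0) : (amplitude Γ δG δB : K) = 0 := by
  rw [amplitude_eq, if_neg]
  rintro ⟨-, hrow⟩
  exact hne (hrow.dotProduct_eq_zero hker)

open Classical in
/-- **The nullspace test, `δ_G` half** (symmetric `Γ`): a nullspace vector `x_R` with `δ_G · x_R =
1`
forces the amplitude to vanish (`δ_G ∉ Col(Γ) = Row(Γ)`). [cite: MaslovEtAl2024, p. 6 (“zero
whenever δ_G^y · x_R = 1 … since x_R belongs to the nullspace of Γ, it is orthogonal to any vector
in
the row space or the column space of Γ”)] -/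
theorem amplitude_eq_zero_of_ker_witness_G [NeZero (2 : K)] {Γ : Matrix B B (ZMod 2)}
    (hΓ : Γ.IsSymm) {δG : B → ZMod 2} (δB : B → ZMod 2) {xR : B → ZMod 2} (hker : Γ *ᵥ xR = 0)
    (hne : δG ⬝ᵥ xR ≠ 0) : (amplitude Γ δG δB : K) = 0 := by
  rw [amplitude_eq, if_neg]
  rintro ⟨hcol, -⟩
  exact hne (((inRow_iff_inCol_of_isSymm hΓ δG).2 hcol).dotProduct_eq_zero hker)

end BipartiteCZAmplitude

end Literature.Computability.QuantumComplexity

end
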